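import Summits.QuantumAdvantage.QuantumAdvantage.Theses.CommutingDeciders
import Literature.Computability.Complexity.PromiseZPPProofs

/-!
# Sketch — crux-strategist decomposition of `CommutingDeciders.CommutingWitness` (stmt-QuantumAdvantage-2639)

Decomposition A (promise factorisation, exact):
  `CommutingWitness ⟸ CommutingPromiseWitness ∧ CommutingPromiseLift`
* `CommutingPromiseWitness` (X₁): some PROMISE problem outside textbook promise-BPP (`PromiseBPP'`)
  has a one-shot commuting decider whose 2/3-vs-1/3 gap is required on the promise only.
* `CommutingPromiseLift` (X₂): the commuting promise→language lift: if every LANGUAGE with a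
  one-shot commuting decider (total gap) is in `BPP`, then every PROMISE problem with a one-shot
  commuting decider (gap on the promise) is in `PromiseBPP'`.
Assembly `CommutingWitness_of_subs : X₁ → X₂ → CommutingWitness` by contraposition (5 lines).
-/

noncomputable section

namespace Summit.QuantumAdvantage.QuantumAdvantage.Theses.CommutingDeciders

open scoped BigOperators Classical Matrix
open Literature.Computability.Cryptography Literature.Computability.Complexity

/-- X₁ — commuting PROMISE witness. -/
def CommutingPromiseWitness : Prop :=
  ∃ Q : PromiseProblem, Q ∉ PromiseBPP' ∧ ∃ (W : List Bool → ℕ) (D : (x : List Bool) → QCircuit iqpDiag (W x)) (A : Language Bool), A ∈ Classes.P ∧ PolyTimeComputable (id : List Bool → List Bool) (QCircuit.sigmaEncode (G := iqpDiag)) (fun x => (⟨W x, 0, D x⟩ : Σ n m : ℕ, QCircuit iqpDiag (n + m))) ∧ (∀ x ∈ Q.yes, (2 / 3 : ℝ) ≤ ∑ w : QReg (W x), (if boolPair x (List.ofFn w) ∈ A then ‖(iqpUnitary (D x) *ᵥ basisState (fun _ => false)) w‖ ^ 2 else 0)) ∧ (∀ x ∈ Q.no, ∑ w : QReg (W x),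 (if boolPair x (List.ofFn w) ∈ A then ‖(iqpUnitary (D x) *ᵥ basisState (fun _ => false)) w‖ ^ 2 else 0) ≤ (1 / 3 : ℝ))

/-- X₂ — commuting promise→language lift. -/
def CommutingPromiseLift : Prop :=
  (∀ L : Language Bool, (∃ (W : List Bool → ℕ) (D : (x : List Bool) → QCircuit iqpDiag (W x)) (A : Language Bool), A ∈ Classes.P ∧ PolyTimeComputable (id : List Bool → List Bool) (QCircuit.sigmaEncode (G := iqpDiag)) (fun x => (⟨W x, 0, D x⟩ : Σ n m : ℕ, QCircuit iqpDiag (n + m))) ∧ ∀ x : List Bool, (x ∈ L → (2 / 3 : ℝ) ≤ ∑ w : QReg (W x), (if boolPair x (List.ofFn w) ∈ A then ‖(iqpUnitary (D x) *ᵥ basisState (fun _ => false)) w‖ ^ 2 else 0)) ∧ (x ∉ L → ∑ w : QReg (W x), (if boolPair x (List.ofFn w) ∈ A then ‖(iqpUnitary (D x) *ᵥ basisState (fun _ => false)) w‖ ^ 2 else 0) ≤ (1 / 3 : ℝ))) → L ∈ BPP) → ∀ Q : PromiseProblem, (∃ (W : List Bool → ℕ) (D : (x : List Bool) → QCircuit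 iqpDiag (W x)) (A : Language Bool), A ∈ Classes.P ∧ PolyTimeComputable (id : List Bool → List Bool) (QCircuit.sigmaEncode (G := iqpDiag)) (fun x => (⟨W x, 0, D x⟩ : Σ n m : ℕ, QCircuit iqpDiag (n + m))) ∧ (∀ x ∈ Q.yes, (2 / 3 : ℝ) ≤ ∑ w : QReg (W x), (if boolPair x (List.ofFn w) ∈ A then ‖(iqpUnitary (D x) *ᵥ basisState (fun _ => false)) w‖ ^ 2 else 0)) ∧ (∀ x ∈ Q.no, ∑ w : QReg (W x), (if boolPair x (List.ofFn w) ∈ A then ‖(iqpUnitary (D x) *ᵥ basisState (fun _ => false)) w‖ ^ 2 else 0) ≤ (1 / 3 : ℝ))) → Q ∈ PromiseBPP'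

/-- ASSEMBLY (the split glue): `X₁ → X₂ → CommutingWitness`, by contraposition. -/
theorem CommutingWitness_of_subs : CommutingPromiseWitness → CommutingPromiseLift → CommutingWitness := by
  intro h₁ h₂
  by_contra hX
  obtain ⟨Q, hQ, hdec⟩ := h₁
  refine hQ (h₂ ?_ Q hdec)
  intro L hL
  by_contra hBPP
  exact hX ⟨L, hBPP, hL⟩

/-- Converse 1 (record for BC2): `CommutingWitness → CommutingPromiseLift` (vacuously: X falsifies the lift's hypothesis). -/
theorem CommutingPromiseLift_of_witness : CommutingWitness → CommutingPromiseLift := by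
  rintro ⟨L, hBPP, hdec⟩ hall
  exact absurd (hall L hdec) hBPP

/-- Converse 2 (record for BC2): `CommutingWitness → CommutingPromiseWitness` (a language is a promise
problem with trivial promise; `ofLanguage_mem_PromiseBPP'_iff`). So the factorisation is EXACT:
`CommutingWitness ↔ CommutingPromiseWitness ∧ CommutingPromiseLift`. -/
theorem CommutingPromiseWitness_of_witness : CommutingWitness → CommutingPromiseWitness := by
  rintro ⟨L, hBPP, W, D, A, hA, hU, hgap⟩
  refine ⟨PromiseProblem.ofLanguage L, ?_, W, D, A, hA, hU, ?_, ?_⟩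
  · rwa [ofLanguage_mem_PromiseBPP'_iff]
  · intro x hx; exact (hgap x).1 hx
  · intro x hx; exact (hgap x).2 hx

theorem CommutingWitness_iff_subs : CommutingWitness ↔ CommutingPromiseWitness ∧ CommutingPromiseLift :=
  ⟨fun h => ⟨CommutingPromiseWitness_of_witness h, CommutingPromiseLift_of_witness h⟩,
   fun h => CommutingWitness_of_subs h.1 h.2⟩

end Summit.QuantumAdvantage.QuantumAdvantage.Theses.CommutingDeciders
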